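import Literature.Computability.MetaComplexity.LevelledRefutationCNFStep
import Literature.Computability.MetaComplexity.LevelledRefutationCNFProbability
import Mathlib.Analysis.SpecialFunctions.Pow.Asymptotics
import Mathlib.Analysis.SpecialFunctions.Log.Basic
import Mathlib.Analysis.Complex.ExponentialBounds
import HarnessLib

/-!
# Proof of Garlík's lower bound for levelled refutation statements

Discharge of the named fact `levelledRefCNF_lowerBound` ([Garlík 2019, Thm 1] = Thm 7,
`LevelledRefutationCNF.lean`): `theorem levelledRefCNF_lowerBound_holds`.

The proof follows [Garlík 2019, §4]. Given `ε > 0` we choose the selection probability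
`p = t^{-1/2}`, the per-level cap `K₀ = ⌈2√t⌉`, the width thresholds `W = ⌈t^{4/5}⌉` and
`T = ⌊t/8⌋`, and `δ = min(1/10, κ/2)` with `κ = (1+ε)/(2(3+ε)) = 1/2 - 1/(3+ε)`. (The
paper takes `p = t^{-a}` with `a = min{(2+ε/2)/(3+ε/2), 3/4} > 2/3`; the constraint `a > 2/3`
came from the forbidden-pattern lemma [Garlík 2019, Lemma 12], which our restriction does not
need, so any `a ∈ (1/5, (2+ε)/(3+ε))` works and we take `a = 1/2`.) Assuming a refutation
`π` of `levelledRefCNF F s t` of length `≤ 2^{t^δ}`, the union bound of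
`LevelledRefutationCNFProbability.lean` (`exists_good_sample`; [Garlík 2019, Lemmas 10, 14])
produces a sample `ω` whose restriction `ρ(ω)` is admissible and `6K₀`-sparse and makes every
clause of `π` satisfied or `(W,T)`-narrow, once `t ≥ t₀(ε)`; the deterministic core
(`levelledRefCNF_core`; [Garlík 2019, Lemmas 16, 17, 19]) then yields the contradiction. The
threshold `t₀` is obtained from limits (`Filter.Tendsto`), not computed.

## References

* M. Garlík, *Resolution lower bounds for refutation statements*, MFCS 2019, LIPIcs 138,
  37:1–37:13 / arXiv:1905.12372, Thm 1 (= Thm 7) and its proof in §4.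
-/

namespace Literature.Computability.MetaComplexity

open _root_.Computability Complexity Filter Finset
open scoped _root_.Topology

namespace LevelledRefCNF

/-! ### Asymptotics: `t^A · e^{B + t^δ - c t^α} → 0` -/

section Asymptotics

/-- The exponent `A log t + B + t^δ - c t^α` tends to `-∞` when `0 ≤ δ < α` and `c > 0`.
[folklore] -/
theorem tendsto_exponent_atBot (A B : ℝ) {c α δ : ℝ} (hc : 0 < c) (hα : 0 < α) (hδ : δ < α) :
    Tendsto (fun t : ℝ => A * Real.log t + B + t ^ δ - c * t ^ α) atTop atBot := by
  -- write the exponent as `t^α · (A log t / t^α + B t^{-α} + t^{δ-α} - c)` for large `t`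
  have h1 : Tendsto (fun t : ℝ => A * (Real.log t / t ^ α)) atTop (𝓝 (A * 0)) :=
    (isLittleO_log_rpow_atTop hα).tendsto_div_nhds_zero.const_mul A
  have h2 : Tendsto (fun t : ℝ => B * t ^ (-α)) atTop (𝓝 (B * 0)) :=
    (tendsto_rpow_neg_atTop hα).const_mul B
  have h3 : Tendsto (fun t : ℝ => t ^ (-(α - δ))) atTop (𝓝 0) :=
    tendsto_rpow_neg_atTop (by linarith)
  have hbr : Tendsto (fun t : ℝ => A * (Real.log t / t ^ α) + B * t ^ (-α) + t ^ (-(α - δ)) - c)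
      atTop (𝓝 (A * 0 + B * 0 + 0 - c)) := ((h1.add h2).add h3).sub_const c
  rw [mul_zero, mul_zero, add_zero, zero_add, zero_sub] at hbr
  have hprod := Tendsto.atTop_mul_neg (neg_lt_zero.2 hc) (tendsto_rpow_atTop hα) hbr
  refine hprod.congr' ?_
  filter_upwards [eventually_gt_atTop (0 : ℝ)] with t ht
  have htα : t ^ α ≠ 0 := (Real.rpow_pos_of_pos ht α).ne'
  have e1 : t ^ α * (t ^ (-α)) = 1 := by rw [Real.rpow_neg ht.le, mul_inv_cancel₀ htα]
  have e2 : t ^ α * t ^ (-(α - δ)) = t ^ δ := by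
    rw [← Real.rpow_add ht]; ring_nf
  calc t ^ α * (A * (Real.log t / t ^ α) + B * t ^ (-α) + t ^ (-(α - δ)) - c)
      = A * Real.log t * (t ^ α / t ^ α) + B * (t ^ α * t ^ (-α)) + t ^ α * t ^ (-(α - δ)) -
          c * t ^ α := by ring
    _ = A * Real.log t + B + t ^ δ - c * t ^ α := by rw [div_self htα, e1, e2]; ring

/-- **Master estimate**: `t^A · exp(B + t^δ - c t^α) → 0` as `t → ∞` (`0 ≤ δ < α`, `c > 0`).
[folklore] -/
theorem tendsto_rpow_mul_exp (A B : ℝ) {c α δ : ℝ} (hc : 0 < c) (hα : 0 < α) (hδ : δ < α) :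
    Tendsto (fun t : ℝ => t ^ A * Real.exp (B + t ^ δ - c * t ^ α)) atTop (𝓝 0) := by
  have h := Real.tendsto_exp_atBot.comp (tendsto_exponent_atBot A B hc hα hδ)
  refine h.congr' ?_
  filter_upwards [eventually_gt_atTop (0 : ℝ)] with t ht
  simp only [Function.comp_apply]
  rw [Real.rpow_def_of_pos ht A, ← Real.exp_add]
  congr 1
  ring

/-- The same along the natural numbers. [folklore] -/
theorem tendsto_rpow_mul_exp_nat (A B : ℝ) {c α δ : ℝ} (hc : 0 < c) (hα : 0 < α) (hδ : δ < α) :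
    Tendsto (fun t : ℕ => (t : ℝ) ^ A * Real.exp (B + (t : ℝ) ^ δ - c * (t : ℝ) ^ α)) atTop (𝓝 0) :=
  (tendsto_rpow_mul_exp A B hc hα hδ).comp tendsto_natCast_atTop_atTop

/-- `t^{-y} → 0` along the naturals (`y > 0`). [folklore] -/
theorem tendsto_rpow_neg_nat {y : ℝ} (hy : 0 < y) :
    Tendsto (fun t : ℕ => (t : ℝ) ^ (-y)) atTop (𝓝 0) :=
  (tendsto_rpow_neg_atTop hy).comp tendsto_natCast_atTop_atTop

end Asymptotics

/-! ### The parameters as functions of `t` -/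

section Parameters

/-- The per-level cap `K₀ = ⌈2√t⌉`. [cite: Garlik2019, Lemma 10 (the bound 2pt, p = t^{-1/2})] -/
noncomputable def K0Of (t : ℕ) : ℕ := ⌈2 * Real.sqrt t⌉₊

/-- The width threshold `W = ⌈t^{4/5}⌉`. [cite: Garlik2019, §4 (w = t^{4/5})] -/
noncomputable def WOf (t : ℕ) : ℕ := ⌈(t : ℝ) ^ (4 / 5 : ℝ)⌉₊

/-- The column threshold `T = ⌊t/8⌋`. [cite: Garlik2019, Lemma 14 (vi), (vii) (the bound t/4,
here t/8)] -/
def TOf (t : ℕ) : ℕ := t / 8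

variable {t : ℕ}

/-- `2√t ≤ K₀`. [folklore] -/
theorem le_K0Of (t : ℕ) : 2 * Real.sqrt t ≤ K0Of t := Nat.le_ceil _

/-- `K₀ ≤ 2√t + 1`. [folklore] -/
theorem K0Of_le (t : ℕ) : (K0Of t : ℝ) ≤ 2 * Real.sqrt t + 1 :=
  (Nat.ceil_lt_add_one (by positivity)).le

/-- `t^{4/5} ≤ W`. [folklore] -/
theorem le_WOf (t : ℕ) : (t : ℝ) ^ (4 / 5 : ℝ) ≤ WOf t := Nat.le_ceil _

/-- `W ≤ t^{4/5} + 1`. [folklore] -/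
theorem WOf_le (t : ℕ) : (WOf t : ℝ) ≤ (t : ℝ) ^ (4 / 5 : ℝ) + 1 :=
  (Nat.ceil_lt_add_one (by positivity)).le

/-- `T ≤ t/8`. [folklore] -/
theorem TOf_le (t : ℕ) : (TOf t : ℝ) ≤ t / 8 := by
  unfold TOf
  exact (Nat.cast_div_le).trans (by norm_num)

/-- `t/8 - 1 ≤ T`. [folklore] -/
theorem le_TOf (t : ℕ) : (t : ℝ) / 8 - 1 ≤ TOf t := by
  unfold TOf
  have h : t ≤ 8 * (t / 8) + 7 := by omega
  have h' : (t : ℝ) ≤ 8 * ((t / 8 : ℕ) : ℝ) + 7 := by exact_mod_cast h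
  linarith

/-- Truncated subtraction is at least subtraction. [folklore] -/
theorem sub_le_cast_sub (a b : ℕ) : (a : ℝ) - b ≤ ((a - b : ℕ) : ℝ) := by
  have h : a ≤ (a - b) + b := by omega
  have h' : (a : ℝ) ≤ ((a - b : ℕ) : ℝ) + b := by exact_mod_cast h
  linarith

/-- `(1 - x)^k ≤ e^{-xk}` for `0 ≤ x ≤ 1`. [folklore] -/
theorem one_sub_pow_le_exp {x : ℝ} (hx1 : x ≤ 1) (k : ℕ) :
    (1 - x) ^ k ≤ Real.exp (-(x * k)) := by
  calc (1 - x) ^ k ≤ Real.exp (-x) ^ k :=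
        pow_le_pow_left₀ (by linarith) (Real.one_sub_le_exp_neg x) k
    _ = Real.exp (-(x * k)) := by rw [← Real.exp_nat_mul]; ring_nf

/-- `(1 - x)^{a ∸ b} ≤ e^{-x (a - b)}` for `0 ≤ x ≤ 1`. [folklore] -/
theorem one_sub_pow_tsub_le_exp {x : ℝ} (hx0 : 0 ≤ x) (hx1 : x ≤ 1) (a b : ℕ) :
    (1 - x) ^ (a - b) ≤ Real.exp (-(x * ((a : ℝ) - b))) := by
  refine (one_sub_pow_le_exp hx1 (a - b)).trans (Real.exp_le_exp.2 ?_)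
  have := mul_le_mul_of_nonneg_left (sub_le_cast_sub a b) hx0
  linarith

/-- `√t · √t = t` for naturals. [folklore] -/
theorem sqrt_mul_self_nat (t : ℕ) : Real.sqrt t * Real.sqrt t = t :=
  Real.mul_self_sqrt (Nat.cast_nonneg t)

/-- `t^{4/5} = √t · t^{3/10}`. [folklore] -/
theorem rpow_four_fifths (t : ℕ) : (t : ℝ) ^ (4 / 5 : ℝ) = Real.sqrt t * (t : ℝ) ^ (3 / 10 : ℝ) := by
  rw [Real.sqrt_eq_rpow, ← Real.rpow_add' (Nat.cast_nonneg t) (by norm_num)]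
  norm_num

/-- `t = √t · √t` in `rpow` form: `t^{1} = t^{1/2} t^{1/2}`; and `t/ (√t r) = t^{1/2 - β}`-type
identity: `t = √t · t^{β} · t^{1/2 - β}` for `t > 0`. [folklore] -/
theorem nat_eq_sqrt_mul_rpow {t : ℕ} (ht : 0 < t) (β : ℝ) :
    (t : ℝ) = Real.sqrt t * ((t : ℝ) ^ β * (t : ℝ) ^ (1 / 2 - β)) := by
  have htr : (0 : ℝ) < t := by exact_mod_cast ht
  rw [← Real.rpow_add htr, Real.sqrt_eq_rpow, ← Real.rpow_add htr]
  norm_num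

end Parameters

/-! ### Bounding the failure probabilities by clean functions of `t` -/

section Bounds

variable {P : Params}

/-- The clean count bound `4t e^{-√t/3}`. [folklore] -/
noncomputable def f₁ (t : ℕ) : ℝ := 4 * t * Real.exp (-(Real.sqrt t / 3))

/-- **The count bound is small**: with `p = 1/√t` and `K₀ = ⌈2√t⌉`,
`countBound ≤ 4t e^{-√t/3}` (using `2 log 2 - 1 ≥ 1/3`). [cite: Garlik2019, Lemma 10] -/
theorem countBound_le (hst : P.s ≤ P.t) (ht : 1 ≤ P.t) :
    countBound P (1 / Real.sqrt P.t) (K0Of P.t) ≤ f₁ P.t := by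
  have htr : (1 : ℝ) ≤ P.t := by exact_mod_cast ht
  have hq : 1 ≤ Real.sqrt P.t := by rw [Real.le_sqrt (by norm_num) (by linarith)]; simpa using htr
  have hq0 : 0 < Real.sqrt P.t := by linarith
  unfold countBound f₁
  have h1 : (3 * P.s + 1 : ℝ) ≤ 4 * P.t := by
    have : (P.s : ℝ) ≤ P.t := by exact_mod_cast hst
    linarith
  have h2 : (1 / 2 : ℝ) ^ (K0Of P.t + 1) ≤ Real.exp (-(2 * Real.log 2 * Real.sqrt P.t)) := by
    rw [show (1 / 2 : ℝ) ^ (K0Of P.t + 1) = Real.exp (-(Real.log 2 * (K0Of P.t + 1 : ℕ))) by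
      rw [show -(Real.log 2 * ((K0Of P.t + 1 : ℕ) : ℝ)) = ((K0Of P.t + 1 : ℕ) : ℝ) * (-Real.log 2)
        by ring, Real.exp_nat_mul, Real.exp_neg, Real.exp_log two_pos]; norm_num]
    apply Real.exp_le_exp.2
    have hk := le_K0Of P.t
    have hl : 0 < Real.log 2 := Real.log_pos one_lt_two
    push_cast
    nlinarith
  have h3 : Real.exp (1 / Real.sqrt P.t * P.t) = Real.exp (Real.sqrt P.t) := by
    congr 1
    rw [div_mul_eq_mul_div, one_mul, div_eq_iff hq0.ne', sqrt_mul_self_nat]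
  have hl2 : (0.6931471803 : ℝ) < Real.log 2 := Real.log_two_gt_d9
  calc (3 * P.s + 1 : ℝ) * ((1 / 2) ^ (K0Of P.t + 1) * Real.exp (1 / Real.sqrt P.t * P.t))
      ≤ 4 * P.t * (Real.exp (-(2 * Real.log 2 * Real.sqrt P.t)) * Real.exp (Real.sqrt P.t)) := by
        rw [h3]
        exact mul_le_mul h1 (mul_le_mul_of_nonneg_right h2 (Real.exp_pos _).le)
          (by positivity) (by positivity)
    _ = 4 * P.t * Real.exp (-(2 * Real.log 2 - 1) * Real.sqrt P.t) := by
        rw [← Real.exp_add]; ring_nf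
    _ ≤ 4 * P.t * Real.exp (-(Real.sqrt P.t / 3)) := by
        apply mul_le_mul_of_nonneg_left _ (by positivity)
        apply Real.exp_le_exp.2
        nlinarith

/-- The clean clause bound `5t e^{6 - t^{3/10}/4} + 2t² e^{6 - t^κ/8}`. [folklore] -/
noncomputable def f₂ (κ : ℝ) (t : ℕ) : ℝ :=
  5 * t * Real.exp (6 - (t : ℝ) ^ (3 / 10 : ℝ) / 4) + 2 * t ^ 2 * Real.exp (6 - (t : ℝ) ^ κ / 8)

/-- **The clause bound is small**: with `p = 1/√t`, `K₀ = ⌈2√t⌉`, `W = ⌈t^{4/5}⌉`,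
`T = ⌊t/8⌋`, `t ≥ 64`, `2 ≤ n ≤ r ≤ t^β` (`κ = 1/2 - β`) and `r ≤ t`,
`clauseBound ≤ 5t e^{6 - t^{3/10}/4} + 2t² e^{6 - t^κ/8}`. [cite: Garlik2019, Lemma 14] -/
theorem clauseBound_le (hst : P.s ≤ P.t) (ht : 64 ≤ P.t) (hn2 : 2 ≤ P.n) (hnr : P.n ≤ P.r)
    (hrt : P.r ≤ P.t) {β : ℝ} (hrβ : (P.r : ℝ) ≤ (P.t : ℝ) ^ β) :
    clauseBound P (1 / Real.sqrt P.t) (K0Of P.t) (WOf P.t) (TOf P.t) ≤ f₂ (1 / 2 - β) P.t := by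
  unfold clauseBound f₂
  -- opaque abbreviations
  obtain ⟨q, hqdef⟩ : ∃ q : ℝ, q = Real.sqrt P.t := ⟨_, rfl⟩
  obtain ⟨u, hudef⟩ : ∃ u : ℝ, u = (P.t : ℝ) ^ (3 / 10 : ℝ) := ⟨_, rfl⟩
  obtain ⟨v, hvdef⟩ : ∃ v : ℝ, v = (P.t : ℝ) ^ (1 / 2 - β) := ⟨_, rfl⟩
  rw [← hqdef, ← hudef, ← hvdef]
  obtain ⟨p, hpdef⟩ : ∃ p : ℝ, p = 1 / q := ⟨_, rfl⟩
  rw [← hpdef]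
  -- elementary facts
  have htr : (64 : ℝ) ≤ P.t := by exact_mod_cast ht
  have htr1 : (1 : ℝ) ≤ P.t := by linarith
  have htpos : (0 : ℝ) < P.t := by linarith
  have hq8 : 8 ≤ q := by
    have h64 : (8 : ℝ) ^ 2 ≤ P.t := by norm_num; exact_mod_cast ht
    rw [hqdef]; exact (Real.le_sqrt (by norm_num) htpos.le).2 h64
  have hq0 : 0 < q := by linarith
  have hp0 : 0 < p := by rw [hpdef]; positivity
  have hp8 : p ≤ 1 / 8 := by
    rw [hpdef, div_le_div_iff₀ hq0 (by norm_num)]; linarith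
  have hp1 : p ≤ 1 := by linarith
  have hpq : p * q = 1 := by rw [hpdef]; field_simp
  have hrr : (2 : ℝ) ≤ P.r := by exact_mod_cast (hn2.trans hnr)
  have hnn : (2 : ℝ) ≤ P.n := by exact_mod_cast hn2
  have hnrr : (P.n : ℝ) ≤ P.r := by exact_mod_cast hnr
  have hrtr : (P.r : ℝ) ≤ P.t := by exact_mod_cast hrt
  have hsr : (P.s : ℝ) ≤ P.t := by exact_mod_cast hst
  have hk : (K0Of P.t : ℝ) ≤ 2 * q + 1 := by rw [hqdef]; exact K0Of_le P.t
  have hw : (P.t : ℝ) ^ (4 / 5 : ℝ) ≤ WOf P.t := le_WOf P.t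
  have hT : (P.t : ℝ) / 8 - 1 ≤ TOf P.t := le_TOf P.t
  have hu0 : 0 ≤ u := by rw [hudef]; positivity
  have hv0 : 0 ≤ v := by rw [hvdef]; positivity
  -- `p · t^{4/5} = u`
  have hpu : p * (P.t : ℝ) ^ (4 / 5 : ℝ) = u := by
    rw [rpow_four_fifths, ← hqdef, ← hudef, ← mul_assoc, hpq, one_mul]
  -- `(p / m) · t ≥ v` for `2 ≤ m ≤ r`
  have hpv : ∀ m : ℝ, 2 ≤ m → m ≤ P.r → v ≤ p / m * P.t := by
    intro m hm2 hmr
    have hm0 : 0 < m := by linarith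
    have htβ : m ≤ (P.t : ℝ) ^ β := hmr.trans hrβ
    have hdecomp : (P.t : ℝ) = q * ((P.t : ℝ) ^ β * v) := by
      rw [hvdef, hqdef]; exact nat_eq_sqrt_mul_rpow (by omega) β
    have e : p / m * P.t = ((P.t : ℝ) ^ β / m) * v := by
      conv_lhs => rw [hpdef, hdecomp]
      field_simp
    rw [e]
    have h1 : 1 ≤ (P.t : ℝ) ^ β / m := by rw [le_div_iff₀ hm0]; linarith
    calc v = 1 * v := (one_mul v).symm
      _ ≤ (P.t : ℝ) ^ β / m * v := mul_le_mul_of_nonneg_right h1 hv0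
  -- `(p/m)·(a q + b) ≤ a/2 + b/16` for `m ≥ 2`
  have hsmall : ∀ m a b : ℝ, 2 ≤ m → 0 ≤ a → 0 ≤ b → p / m * (a * q + b) ≤ a / 2 + b / 16 := by
    intro m a b hm ha hb
    have hm0 : 0 < m := by linarith
    have e1 : p / m * (a * q + b) = (a * (p * q) + b * p) / m := by ring
    rw [e1, hpq, div_le_iff₀ hm0]
    have h1 : (a / 2 + b / 16) * 2 ≤ (a / 2 + b / 16) * m :=
      mul_le_mul_of_nonneg_left hm (by positivity)
    have h2 : b * p ≤ b * (1 / 8) := mul_le_mul_of_nonneg_left hp8 hb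
    linarith
  -- generic term estimate
  have hterm : ∀ (x : ℝ), 0 ≤ x → x ≤ 1 → ∀ (a b : ℕ) (A Bb : ℝ), A ≤ x * a → x * b ≤ Bb →
      (1 - x) ^ (a - b) ≤ Real.exp (Bb - A) := by
    intro x hx0 hx1 a b A Bb hA hB
    refine (one_sub_pow_tsub_le_exp hx0 hx1 a b).trans (Real.exp_le_exp.2 ?_)
    have : x * ((a : ℝ) - b) = x * a - x * b := by ring
    linarith
  -- the five terms
  have hp2 : 0 ≤ p / 2 := by positivity
  have hp2' : p / 2 ≤ 1 := by linarith
  have hp4 : 0 ≤ p / 4 := by positivity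
  have hp4' : p / 4 ≤ 1 := by linarith
  have t1 : (1 - p / 2) ^ (WOf P.t - 4 * K0Of P.t) ≤ Real.exp (5 - u / 2) := by
    refine (hterm (p / 2) hp2 hp2' _ _ (u / 2) 5 ?_ ?_).trans (le_of_eq (by ring_nf))
    · have := mul_le_mul_of_nonneg_left hw hp2
      have e : p / 2 * (P.t : ℝ) ^ (4 / 5 : ℝ) = u * (1 / 2) := by rw [← hpu]; ring
      linarith
    · push_cast
      have hk' : p / 2 * (4 * (K0Of P.t : ℝ)) ≤ p / 2 * (4 * (2 * q + 1)) :=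
        mul_le_mul_of_nonneg_left (by linarith) hp2
      have e : p / 2 * (4 * (2 * q + 1)) = (p * q) * 4 + p * 2 := by ring
      rw [hpq] at e
      linarith
  have t2 : (1 - p / 2) ^ (WOf P.t - 2 * K0Of P.t) ≤ Real.exp (5 - u / 2) := by
    refine (hterm (p / 2) hp2 hp2' _ _ (u / 2) 5 ?_ ?_).trans (le_of_eq (by ring_nf))
    · have := mul_le_mul_of_nonneg_left hw hp2
      have e : p / 2 * (P.t : ℝ) ^ (4 / 5 : ℝ) = u * (1 / 2) := by rw [← hpu]; ring
      linarith
    · push_cast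
      have hk' : p / 2 * (2 * (K0Of P.t : ℝ)) ≤ p / 2 * (2 * (2 * q + 1)) :=
        mul_le_mul_of_nonneg_left (by linarith) hp2
      have e : p / 2 * (2 * (2 * q + 1)) = (p * q) * 2 + p := by ring
      rw [hpq] at e
      linarith
  have t3 : (1 - p / 4) ^ (WOf P.t - 2 * K0Of P.t) ≤ Real.exp (5 - u / 4) := by
    refine (hterm (p / 4) hp4 hp4' _ _ (u / 4) 5 ?_ ?_).trans (le_of_eq (by ring_nf))
    · have := mul_le_mul_of_nonneg_left hw hp4
      have e : p / 4 * (P.t : ℝ) ^ (4 / 5 : ℝ) = u * (1 / 4) := by rw [← hpu]; ring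
      linarith
    · push_cast
      have hk' : p / 4 * (2 * (K0Of P.t : ℝ)) ≤ p / 4 * (2 * (2 * q + 1)) :=
        mul_le_mul_of_nonneg_left (by linarith) hp4
      have e : p / 4 * (2 * (2 * q + 1)) = (p * q) + p * (1 / 2) := by ring
      rw [hpq] at e
      linarith
  have hxr0 : 0 ≤ p / P.r := by positivity
  have hxr1 : p / P.r ≤ 1 := by rw [div_le_one (by linarith)]; linarith
  have t4 : (1 - p / P.r) ^ (TOf P.t - 2 * K0Of P.t) ≤ Real.exp (5 - v / 8) := by
    refine (hterm (p / P.r) hxr0 hxr1 _ _ (v / 8 - 1) 4 ?_ ?_).trans (le_of_eq (by ring_nf))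
    · have h := mul_le_mul_of_nonneg_left hT hxr0
      have hv' := hpv P.r hrr le_rfl
      have e : p / P.r * ((P.t : ℝ) / 8 - 1) = (p / P.r * P.t) / 8 - p / P.r := by ring
      linarith
    · push_cast
      have h1 := hsmall P.r 4 2 hrr (by norm_num) (by norm_num)
      have h2 : p / P.r * (2 * (K0Of P.t : ℝ)) ≤ p / P.r * (4 * q + 2) :=
        mul_le_mul_of_nonneg_left (by linarith) hxr0
      linarith
  have hxn0 : 0 ≤ p / P.n := by positivity
  have hxn1 : p / P.n ≤ 1 := by rw [div_le_one (by linarith)]; linarith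
  have t5 : (1 - p / P.n) ^ (TOf P.t - 4 * K0Of P.t) ≤ Real.exp (6 - v / 8) := by
    refine (hterm (p / P.n) hxn0 hxn1 _ _ (v / 8 - 1) 5 ?_ ?_).trans (le_of_eq (by ring_nf))
    · have h := mul_le_mul_of_nonneg_left hT hxn0
      have hv' := hpv P.n hnn hnrr
      have e : p / P.n * ((P.t : ℝ) / 8 - 1) = (p / P.n * P.t) / 8 - p / P.n := by ring
      linarith
    · push_cast
      have h1 := hsmall P.n 8 4 hnn (by norm_num) (by norm_num)
      have h2 : p / P.n * (4 * (K0Of P.t : ℝ)) ≤ p / P.n * (8 * q + 4) :=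
        mul_le_mul_of_nonneg_left (by linarith) hxn0
      linarith
  -- assemble
  have eu : Real.exp (5 - u / 2) ≤ Real.exp (6 - u / 4) := Real.exp_le_exp.2 (by linarith)
  have eu' : Real.exp (5 - u / 4) ≤ Real.exp (6 - u / 4) := Real.exp_le_exp.2 (by linarith)
  have ev : Real.exp (5 - v / 8) ≤ Real.exp (6 - v / 8) := Real.exp_le_exp.2 (by linarith)
  have E1 := Real.exp_pos (6 - u / 4)
  have E2 := Real.exp_pos (6 - v / 8)
  have hs2 : (2 : ℝ) * P.s ≤ 2 * P.t := by linarith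
  have hx2 : 0 ≤ 1 - p / 2 := by linarith
  have hx4 : 0 ≤ 1 - p / 4 := by linarith
  have hxr : 0 ≤ 1 - p / P.r := by linarith
  have hxn : 0 ≤ 1 - p / P.n := by linarith
  have i1 : 2 * (P.s : ℝ) * (1 - p / 2) ^ (WOf P.t - 4 * K0Of P.t) ≤
      2 * P.t * Real.exp (6 - u / 4) :=
    mul_le_mul hs2 (t1.trans eu) (pow_nonneg hx2 _) (by positivity)
  have i2 : (1 - p / 2) ^ (WOf P.t - 2 * K0Of P.t) ≤ Real.exp (6 - u / 4) := t2.trans eu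
  have i3 : 2 * (P.s : ℝ) * (1 - p / 4) ^ (WOf P.t - 2 * K0Of P.t) ≤
      2 * P.t * Real.exp (6 - u / 4) :=
    mul_le_mul hs2 (t3.trans eu') (pow_nonneg hx4 _) (by positivity)
  have i4 : (P.r : ℝ) * (1 - p / P.r) ^ (TOf P.t - 2 * K0Of P.t) ≤ P.t * Real.exp (6 - v / 8) :=
    mul_le_mul hrtr (t4.trans ev) (pow_nonneg hxr _) htpos.le
  have hsn : (P.s : ℝ) * P.n ≤ P.t * P.t :=
    mul_le_mul hsr (hnrr.trans hrtr) (by positivity) htpos.le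
  have i5 : (P.s : ℝ) * P.n * (1 - p / P.n) ^ (TOf P.t - 4 * K0Of P.t) ≤
      P.t * P.t * Real.exp (6 - v / 8) :=
    mul_le_mul hsn t5 (pow_nonneg hxn _) (by positivity)
  have h1 : Real.exp (6 - u / 4) ≤ P.t * Real.exp (6 - u / 4) := by
    calc Real.exp (6 - u / 4) = 1 * Real.exp (6 - u / 4) := (one_mul _).symm
      _ ≤ P.t * Real.exp (6 - u / 4) := mul_le_mul_of_nonneg_right htr1 E1.le
  have h2 : (P.t : ℝ) * Real.exp (6 - v / 8) ≤ P.t * P.t * Real.exp (6 - v / 8) := by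
    calc (P.t : ℝ) * Real.exp (6 - v / 8) = 1 * (P.t * Real.exp (6 - v / 8)) := (one_mul _).symm
      _ ≤ P.t * (P.t * Real.exp (6 - v / 8)) :=
          mul_le_mul_of_nonneg_right htr1 (mul_nonneg htpos.le E2.le)
      _ = P.t * P.t * Real.exp (6 - v / 8) := by ring
  have e2 : (P.t : ℝ) ^ 2 = P.t * P.t := by ring
  rw [e2]
  linarith

end Bounds

/-! ### The limit and the thresholds -/

section Limit

/-- `2^x ≤ e^x` for `x ≥ 0`. [folklore] -/
theorem two_rpow_le_exp {x : ℝ} (hx : 0 ≤ x) : (2 : ℝ) ^ x ≤ Real.exp x := by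
  rw [Real.rpow_def_of_pos (by norm_num : (0 : ℝ) < 2)]
  apply Real.exp_le_exp.2
  have := Real.log_two_lt_d9
  nlinarith

/-- The total failure bound `f₁ t + e^{t^δ} f₂ κ t` tends to `0` when `0 ≤ δ`, `δ < 3/10` and
`δ < κ`. [folklore] -/
theorem tendsto_total {δ κ : ℝ} (hδ0 : 0 ≤ δ) (hδ3 : δ < 3 / 10) (hδκ : δ < κ) :
    Tendsto (fun t : ℕ => f₁ t + Real.exp ((t : ℝ) ^ δ) * f₂ κ t) atTop (𝓝 0) := by
  have hκ : 0 < κ := lt_of_le_of_lt hδ0 hδκ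
  have h1 := tendsto_rpow_mul_exp_nat 1 (Real.log 4 - 1) (c := 1 / 3) (α := 1 / 2) (δ := 0)
    (by norm_num) (by norm_num) (by norm_num)
  have h2 := tendsto_rpow_mul_exp_nat 1 (6 + Real.log 5) (c := 1 / 4) (α := 3 / 10) (δ := δ)
    (by norm_num) (by norm_num) hδ3
  have h3 := tendsto_rpow_mul_exp_nat 2 (6 + Real.log 2) (c := 1 / 8) (α := κ) (δ := δ)
    (by norm_num) hκ hδκ
  have hsum := (h1.add h2).add h3
  rw [add_zero, add_zero] at hsum
  refine hsum.congr' ?_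
  filter_upwards [eventually_gt_atTop 0] with t ht
  have htr : (0 : ℝ) < t := by exact_mod_cast ht
  unfold f₁ f₂
  have e4 : Real.exp (Real.log 4) = 4 := Real.exp_log (by norm_num)
  have e5 : Real.exp (Real.log 5) = 5 := Real.exp_log (by norm_num)
  have e2 : Real.exp (Real.log 2) = 2 := Real.exp_log (by norm_num)
  rw [Real.rpow_one, Real.rpow_zero, show ((t : ℝ) ^ (2 : ℝ)) = (t : ℝ) ^ 2 by norm_cast,
    Real.sqrt_eq_rpow]
  have x1 : Real.exp (Real.log 4 - 1 + 1 - 1 / 3 * (t : ℝ) ^ (1 / 2 : ℝ)) =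
      4 * Real.exp (-((t : ℝ) ^ (1 / 2 : ℝ) / 3)) := by
    rw [show Real.log 4 - 1 + 1 - 1 / 3 * (t : ℝ) ^ (1 / 2 : ℝ) =
      Real.log 4 + -((t : ℝ) ^ (1 / 2 : ℝ) / 3) by ring, Real.exp_add, e4]
  have x2 : Real.exp (6 + Real.log 5 + (t : ℝ) ^ δ - 1 / 4 * (t : ℝ) ^ (3 / 10 : ℝ)) =
      Real.exp ((t : ℝ) ^ δ) * (5 * Real.exp (6 - (t : ℝ) ^ (3 / 10 : ℝ) / 4)) := by
    rw [show 6 + Real.log 5 + (t : ℝ) ^ δ - 1 / 4 * (t : ℝ) ^ (3 / 10 : ℝ) =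
      (t : ℝ) ^ δ + (Real.log 5 + (6 - (t : ℝ) ^ (3 / 10 : ℝ) / 4)) by ring, Real.exp_add,
      Real.exp_add, e5]
  have x3 : Real.exp (6 + Real.log 2 + (t : ℝ) ^ δ - 1 / 8 * (t : ℝ) ^ κ) =
      Real.exp ((t : ℝ) ^ δ) * (2 * Real.exp (6 - (t : ℝ) ^ κ / 8)) := by
    rw [show 6 + Real.log 2 + (t : ℝ) ^ δ - 1 / 8 * (t : ℝ) ^ κ =
      (t : ℝ) ^ δ + (Real.log 2 + (6 - (t : ℝ) ^ κ / 8)) by ring, Real.exp_add, Real.exp_add, e2]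
  rw [x1, x2, x3]
  ring

/-- `56 ≤ t^{1/5}` for `t ≥ 56^5`. [folklore] -/
theorem rpow_fifth_ge {t : ℕ} (ht : 56 ^ 5 ≤ t) : (56 : ℝ) ≤ (t : ℝ) ^ (1 / 5 : ℝ) := by
  rw [show (1 / 5 : ℝ) = ((5 : ℕ) : ℝ)⁻¹ by norm_num]
  calc (56 : ℝ) = ((56 : ℝ) ^ 5) ^ ((5 : ℕ) : ℝ)⁻¹ :=
        (Real.pow_rpow_inv_natCast (by norm_num) (by norm_num)).symm
    _ ≤ (t : ℝ) ^ ((5 : ℕ) : ℝ)⁻¹ :=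
        Real.rpow_le_rpow (by positivity) (by exact_mod_cast ht) (by positivity)

/-- **The numeric side conditions** for `t ≥ 56^5`: `16K₀ + 16 ≤ t` and
`2(3·6K₀ + 7W + T) + 1 ≤ t`. [folklore] -/
theorem numeric_conditions {t : ℕ} (ht : 56 ^ 5 ≤ t) :
    16 * K0Of t + 16 ≤ t ∧ 2 * (3 * (6 * K0Of t) + 7 * WOf t + TOf t) + 1 ≤ t := by
  have htr : ((56 : ℕ) ^ 5 : ℝ) ≤ t := by exact_mod_cast ht
  have htr' : (82944 : ℝ) ≤ t := le_trans (by norm_num) htr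
  have htpos : (0 : ℝ) < t := by linarith
  set q := Real.sqrt t with hq
  have hq288 : 288 ≤ q := by
    rw [hq, Real.le_sqrt (by norm_num) htpos.le]; norm_num; linarith
  have hqq : q * q = t := sqrt_mul_self_nat t
  have hk : (K0Of t : ℝ) ≤ 2 * q + 1 := K0Of_le t
  have hw : (WOf t : ℝ) ≤ (t : ℝ) ^ (4 / 5 : ℝ) + 1 := WOf_le t
  have hT : (TOf t : ℝ) ≤ t / 8 := TOf_le t
  have h5 : (56 : ℝ) ≤ (t : ℝ) ^ (1 / 5 : ℝ) := rpow_fifth_ge ht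
  have h45 : (t : ℝ) ^ (4 / 5 : ℝ) * (t : ℝ) ^ (1 / 5 : ℝ) = t := by
    rw [← Real.rpow_add htpos]; norm_num
  have hw' : 56 * (t : ℝ) ^ (4 / 5 : ℝ) ≤ t := by
    have := mul_le_mul_of_nonneg_left h5 (by positivity : (0 : ℝ) ≤ (t : ℝ) ^ (4 / 5 : ℝ))
    linarith
  have hq' : 288 * q ≤ t := by nlinarith
  constructor
  · have : (16 * K0Of t + 16 : ℝ) ≤ t := by nlinarith
    exact_mod_cast this
  · have : (2 * (3 * (6 * K0Of t) + 7 * WOf t + TOf t) + 1 : ℝ) ≤ t := by nlinarith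
    exact_mod_cast this

end Limit

/-! ### The theorem -/

section Main

/-- `clauseBound ≥ 0` when `p ≤ 1 ≤ n, r`. [folklore] -/
theorem clauseBound_nonneg {P : Params} {p : ℝ} (hp1 : p ≤ 1) (hn : 1 ≤ P.n)
    (hr : 1 ≤ P.r) (K₀ W T : ℕ) : 0 ≤ clauseBound P p K₀ W T := by
  unfold clauseBound
  have hnr : (1 : ℝ) ≤ P.r := by exact_mod_cast hr
  have hnn : (1 : ℝ) ≤ P.n := by exact_mod_cast hn
  have h2 : 0 ≤ 1 - p / 2 := by linarith
  have h4 : 0 ≤ 1 - p / 4 := by linarith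
  have hr' : 0 ≤ 1 - p / P.r := by
    have : p / P.r ≤ 1 := by rw [div_le_one (by linarith)]; linarith
    linarith
  have hn' : 0 ≤ 1 - p / P.n := by
    have : p / P.n ≤ 1 := by rw [div_le_one (by linarith)]; linarith
    linarith
  positivity

/-- `r ≤ t^{1/(3+ε)}` and `r ≤ t` from `r^{3+ε} ≤ t`. [folklore] -/
theorem r_bounds {r t : ℕ} {ε : ℝ} (hε : 0 < ε) (hr : 1 ≤ r) (h : (r : ℝ) ^ (3 + ε) ≤ t) :
    (r : ℝ) ≤ (t : ℝ) ^ (1 / (3 + ε)) ∧ r ≤ t := by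
  have hr1 : (1 : ℝ) ≤ r := by exact_mod_cast hr
  have hr0 : (0 : ℝ) ≤ r := by linarith
  have h3 : (0 : ℝ) < 3 + ε := by linarith
  constructor
  · have := Real.rpow_le_rpow (by positivity) h (by positivity : (0 : ℝ) ≤ 1 / (3 + ε))
    rwa [← Real.rpow_mul hr0, show (3 + ε) * (1 / (3 + ε)) = 1 by field_simp, Real.rpow_one] at this
  · have h1 : (r : ℝ) ≤ (r : ℝ) ^ (3 + ε) := by
      calc (r : ℝ) = (r : ℝ) ^ (1 : ℝ) := (Real.rpow_one _).symm
        _ ≤ (r : ℝ) ^ (3 + ε) := Real.rpow_le_rpow_of_exponent_le hr1 (by linarith)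
    exact_mod_cast h1.trans h

end Main

end LevelledRefCNF

open LevelledRefCNF in
/-- **Garlík's lower bound for levelled refutation statements** — discharge of the named fact
`levelledRefCNF_lowerBound` [Garlík 2019, Thm 1 (= Thm 7)]: for every `ε > 0` there are
`δ > 0` and `t₀` such that for `t ≥ s ≥ n + 1`, `r ≥ n ≥ 2`, `t ≥ r^{3+ε}`, `t ≥ t₀` and `F`
an unsatisfiable CNF of `r` non-tautological clauses in `n` variables, every resolution
refutation of `REF^F_{s,t} = levelledRefCNF F s t` has length `> 2^{t^δ}`. Proof: [Garlík 2019,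
§4] with the random restriction of `LevelledRefutationCNFRestriction.lean` (`p = t^{-1/2}`,
`δ = min(1/10, (1/2 - 1/(3+ε))/2)`), the width reduction / union bound of
`LevelledRefutationCNFProbability.lean` and the deterministic core of
`LevelledRefutationCNFStep.lean`. [cite: Garlik2019, Thm 1] -/
theorem levelledRefCNF_lowerBound_holds : levelledRefCNF_lowerBound := by
  intro ε hε
  -- the exponents
  set β : ℝ := 1 / (3 + ε) with hβ
  set κ : ℝ := 1 / 2 - β with hκ
  have h3 : (0 : ℝ) < 3 + ε := by linarith
  have hβlt : β < 1 / 3 := by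
    rw [hβ, div_lt_div_iff₀ h3 (by norm_num)]; linarith
  have hκpos : 0 < κ := by rw [hκ]; linarith
  set δ : ℝ := min (1 / 10) (κ / 2) with hδ
  have hδpos : 0 < δ := lt_min (by norm_num) (by linarith)
  have hδ0 : 0 ≤ δ := hδpos.le
  have hδ3 : δ < 3 / 10 := lt_of_le_of_lt (min_le_left _ _) (by norm_num)
  have hδκ : δ < κ := lt_of_le_of_lt (min_le_right _ _) (by linarith)
  refine ⟨δ, hδpos, ?_⟩
  -- the threshold
  have hev : ∀ᶠ t : ℕ in atTop, f₁ t + Real.exp ((t : ℝ) ^ δ) * f₂ κ t < 1 ∧ 56 ^ 5 ≤ t :=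
    ((tendsto_total hδ0 hδ3 hδκ).eventually_lt_const one_pos).and (eventually_ge_atTop _)
  obtain ⟨t₀, ht₀⟩ := eventually_atTop.1 hev
  refine ⟨t₀, ?_⟩
  intro F s t hst hs hn2 hnr hrt ht0 hnt hunsat π hπ
  obtain ⟨hlt1, ht56⟩ := ht₀ t ht0
  by_contra hlen
  rw [not_lt] at hlen
  -- parameters
  set n := (CNF.vars F).card with hn
  set r := F.length with hr
  have hn1 : 1 ≤ n := by omega
  have hr1 : 1 ≤ r := by omega
  have hr2 : 2 ≤ r := by omega
  obtain ⟨hrβ, hrtn⟩ := r_bounds hε hr1 hrt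
  have ht64 : 64 ≤ t := le_trans (by norm_num) ht56
  have htr1 : (1 : ℝ) ≤ t := by exact_mod_cast (le_trans (by norm_num) ht64 : 1 ≤ t)
  obtain ⟨hK, hnum⟩ := numeric_conditions ht56
  set P : Params := params F s t with hP
  have hcore : CoreHyp P (fclause (sortedVars F) F) := coreHyp_params hn1 hs hst hnt hunsat
  have hsqrt1 : 1 ≤ Real.sqrt t := Real.one_le_sqrt.2 htr1
  set prm : ProbParams P :=
    { p := 1 / Real.sqrt t
      p_nonneg := by positivity
      p_le_one := by rw [div_le_one (by linarith)]; exact hsqrt1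
      n_pos := by show 0 < n; omega
      r_pos := by show 0 < r; omega
      t_pos := by show 0 < t; omega } with hprm
  -- the clauses of the refutation
  classical
  set 𝓔 : Finset (Finset (Literal ℕ)) := (π.map ResLine.clause).toFinset with h𝓔
  have hcard : (𝓔.card : ℝ) ≤ Real.exp ((t : ℝ) ^ δ) := by
    have h1 : 𝓔.card ≤ π.length := by
      rw [h𝓔]; exact (List.toFinset_card_le _).trans (by simp)
    have h1' : (𝓔.card : ℝ) ≤ π.length := by exact_mod_cast h1
    exact (h1'.trans hlen).trans (two_rpow_le_exp (by positivity))
  -- the union bound applies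
  have hbound : countBound P prm.p (K0Of t) + 𝓔.card * clauseBound P prm.p (K0Of t) (WOf t) (TOf t)
      < 1 := by
    have hc : countBound P prm.p (K0Of t) ≤ f₁ t := countBound_le (P := P) hst (show 1 ≤ t by omega)
    have hcl : clauseBound P prm.p (K0Of t) (WOf t) (TOf t) ≤ f₂ κ t := by
      have := clauseBound_le (P := P) hst ht64 hn2 hnr hrtn (β := β) hrβ
      rwa [← hκ] at this
    have hcl0 : 0 ≤ clauseBound P prm.p (K0Of t) (WOf t) (TOf t) :=
      clauseBound_nonneg prm.p_le_one hn1 hr1 _ _ _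
    have := mul_le_mul hcard hcl hcl0 (Real.exp_pos _).le
    linarith
  obtain ⟨ω, hsc, hcl⟩ := exists_good_sample prm hcore hn2 hr2 hK 𝓔 hbound
  -- the deterministic core
  refine levelledRefCNF_core hn1 hs hst hnt hunsat (admissible_rho hcore (K0Of t) ω)
    (levelSparse_rho (Fc := fclause (sortedVars F) F) hsc) hnum hπ fun E hE hns => ?_
  have hE' : E ∈ 𝓔 := by rw [h𝓔, List.mem_toFinset]; exact hE
  exact (hcl E hE').resolve_left hns




end Literature.Computability.MetaComplexity
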